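import Summits.Ventures.PercRepro.RankLevelSetExplicitLin2LargeSharp58
import Summits.Ventures.PercRepro.RankLevelSetExplicitLin2TailOptimal

/-!
# PercRepro — THE LEVEL FROM ANY KEY ROW OVER THE 5/8 RANGE WITH THE OPTIMAL CHERNOFF TAIL AT ITS TOP CORANK (p9, S4)

`proofs/SUBCLAIM-S4-p9.md` §S4.2⁗⁗. p4's `c025_level_succ_of_key_row_tailOpt` (RankLevelSetExplicitLin2TailOptimal) takes the
`(Y)`-tail from ONE kernel inequality at the top core corank `D = q + 1 + 2^{q+1}` — the optimal Chernoff pair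
`16·n₀^{n₀} ≤ 2^{n₀}·(n₀ − K₀)^{n₀−K₀}·K₀^{K₀}` at `n₀ = p₀ + D`, `K₀ = q + 1 + D` — and transfers it down the coranks
(`tail_down`) and up the rank (`tail_up`). With the 5/8 range (RankLevelSetExplicitLin2LargeSharp58: the large-corank theorem
`c025_core_explicit_large_of58` from corank `q + 1 + 5·2^{q−2} + 1`) the same assembly needs the pair only at
`D' = q + 1 + 5·2^{q−2}`: `c025_level_succ_of_key_row_tailOpt58` below is p4's theorem with `D'` for `D`, p4's transfer lemmas
unchanged, and the large-corank theorem of the 5/8 range in place of `c025_core_explicit_large_of'`. Axioms: standard.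
-/

open scoped Matroid

namespace PercRepro

namespace ThmN

variable {α : Type}

/-- **THE LEVEL FROM ONE EVALUATED ROW OVER THE 5/8 RANGE, WITH THE TAIL FROM ONE KERNEL EVALUATION AT ITS TOP CORANK**:
p4's `c025_level_succ_of_key_row_tailOpt` with the core coranks `q + 2 ≤ d ≤ D' = q + 1 + 5·2^{q−2}`, the optimal pair
`htop : 16·n₀^{n₀} ≤ 2^{n₀}·(n₀ − K₀)^{n₀−K₀}·K₀^{K₀}` at `n₀ = p₀ + D'`, `K₀ = q + 1 + D'` (with `2K₀ ≤ n₀`), the row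
`K p₀ d` on those coranks, and `c025_core_explicit_large_of58` beyond them from the bases `N₁`, `P₂` (the flat bound
`5·2^{q−2} − 1`) with `5·2^{q−2} + 1 ≤ p₀`. -/
theorem c025_level_succ_of_key_row_tailOpt58 (q : ℕ) (hq : 7 ≤ q) (p₀ N₁ P₂ : ℕ) (K : ℕ → ℕ → Prop)
    (hN₁ : N₁ ≤ p₀) (hm : 2 * (q + 1) ≤ N₁)
    (hbase₁ : 8 * (q + 1 + 1) * 2 ^ (5 * 2 ^ (q + 1 - 3) - 1 - (q + 1)) * N₁ ^ (q + 1) ≤ 2 ^ N₁)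
    (hP₂ : P₂ ≤ p₀) (hP₂q : q + 1 + 2 ≤ P₂)
    (hbase₂ : 2 ^ (P₂ + (q + 1)) * 2 ^ (5 * 2 ^ (q + 1 - 3) - 1 - (q + 1)) * (2 * (P₂ - 1 - (q + 1)) + 1) ≤
      4 ^ (P₂ - 1 - (q + 1)))
    (hp3 : 5 * 2 ^ (q + 1 - 3) + 1 ≤ p₀)
    (hK₀ : 2 * (q + 1 + (q + 1 + 5 * 2 ^ (q + 1 - 3))) ≤ p₀ + (q + 1 + 5 * 2 ^ (q + 1 - 3)))
    (htop : 16 * (p₀ + (q + 1 + 5 * 2 ^ (q + 1 - 3))) ^ (p₀ + (q + 1 + 5 * 2 ^ (q + 1 - 3))) ≤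
      2 ^ (p₀ + (q + 1 + 5 * 2 ^ (q + 1 - 3))) *
        ((p₀ + (q + 1 + 5 * 2 ^ (q + 1 - 3)) - (q + 1 + (q + 1 + 5 * 2 ^ (q + 1 - 3)))) ^
            (p₀ + (q + 1 + 5 * 2 ^ (q + 1 - 3)) - (q + 1 + (q + 1 + 5 * 2 ^ (q + 1 - 3)))) *
          (q + 1 + (q + 1 + 5 * 2 ^ (q + 1 - 3))) ^ (q + 1 + (q + 1 + 5 * 2 ^ (q + 1 - 3)))))
    (hmono : ∀ p d, q + 1 ≤ d → K p d → K (p + 1) d)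
    (hcore : ∀ (M : Matroid α) [M.Finite] (p d : ℕ), q + 2 ≤ d → d ≤ q + 1 + 5 * 2 ^ (q + 1 - 3) →
      16 * ∑ j ∈ Finset.range (q + 1 + d + 1), (p + d).choose j ≤ 2 ^ (p + d) →
      K p d → M.eRank = (p : ℕ∞) → M.E.ncard = p + d →
      (∀ e ∈ M.E, ∃ A ⊆ M.E \ {e}, e ∉ M.closure A ∧ e ∉ M.closure ((M.E \ {e}) \ A)) → RLS M p (q + 1))
    (hrow : ∀ t < 5 * 2 ^ (q + 1 - 3), K p₀ (q + 2 + t))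
    (hprev : ∀ (M : Matroid α) [M.Finite] (p : ℕ), p₀ - 1 ≤ p → RLS M p q) :
    ∀ (M : Matroid α) [M.Finite] (p : ℕ), p₀ ≤ p → RLS M p (q + 1) := by
  intro M _ p hp
  have h2q : 2 ≤ 5 * 2 ^ (q + 1 - 3) := by
    have : 1 ≤ 2 ^ (q + 1 - 3) := Nat.one_le_two_pow
    omega
  -- the tail at the top corank `D'` from the optimal pair, then at every `p ≥ p₀` and every smaller corank
  have htail0 := Explicit.tail_of_optimal_chernoff (p₀ + (q + 1 + 5 * 2 ^ (q + 1 - 3)))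
    (q + 1 + (q + 1 + 5 * 2 ^ (q + 1 - 3))) hK₀ htop
  have htailp := Explicit.tail_up p₀ (q + 1) (q + 1 + 5 * 2 ^ (q + 1 - 3)) htail0 p hp
  have htaild := Explicit.tail_down p (q + 1) (q + 1 + 5 * 2 ^ (q + 1 - 3)) htailp
  refine rls_succ_large_at (α := α) q (q + 1) p (by omega) (fun M' _ => hprev M' (p - 1) (by omega)) ?_ ?_ M
  · intro M' _ hn
    rcases Nat.lt_or_ge M'.E.ncard (p + (q + 1)) with h | h
    · exact RLS_of_ncard_lt M' h
    · exact RLS_of_ncard_eq M' (by omega)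
  · intro M' _ hR hbig hfree
    rcases Nat.lt_or_ge M'.E.ncard (p + (q + 1) + 5 * 2 ^ (q + 1 - 3) + 1) with h | h
    · have hkey0 := hrow (M'.E.ncard - p - (q + 2)) (by omega)
      rw [show q + 2 + (M'.E.ncard - p - (q + 2)) = M'.E.ncard - p by omega] at hkey0
      have hkey := key_mono_of_succ K (M'.E.ncard - p) (fun p' => hmono p' (M'.E.ncard - p) (by omega)) p₀ p hp hkey0
      have hT := htaild (M'.E.ncard - p) (by omega)
      exact hcore M' p (M'.E.ncard - p) (by omega) (by omega) hT hkey hR (by omega) hfree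
    · exact c025_core_explicit_large_of58 (q + 1) (by omega) N₁ P₂
        (Explicit.regime_one_of_base' (q + 1) (8 * (q + 1 + 1) * 2 ^ (5 * 2 ^ (q + 1 - 3) - 1 - (q + 1))) N₁ hm hbase₁)
        (Explicit.regime_two_of_base_exp (q + 1) (5 * 2 ^ (q + 1 - 3) - 1 - (q + 1)) P₂ hP₂q hbase₂) M' p (hN₁.trans hp)
        (hP₂.trans hp) (hp3.trans hp) hR (by omega) hfree

end ThmN

end PercRepro
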